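import Summits.Ventures.PercRepro.Night2TwoOneVFloor

/-!
# PercRepro — the cell `(2, 1)` with two fat closures: THE KERNEL SUMS AND THE TAIL (night-2, gen 28)

The count sum of a lossy basis pair of the two-fat-closure cell (profile `(3, 2)` along the plane with `|P| = n − 4`
and four off-plane points, the crude count `cntTwoOne i j = C(i, 3) · C(j, 2)`, the chord
`eTwoOne n = (19 n + 193)/(72 (n − 2))`, the floors `vTwoOne n`) is at least `1` at every `n ≥ 9`:
* `9 ≤ n ≤ 18` by kernel evaluation (`qSumW_twoOne_9` … `qSumW_twoOne_18`; the values are `2.51, 2.01, 1.78, 1.85,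
  2.16, 2.77, 3.84, 5.65, 8.69, 13.8`);
* `n ≥ 19` from the `j = 4` terms alone: `Σ_{i ≥ 4} C(n−7, i−3) = 2^{n−7} − 1` targets with floor `13/27` and count
  `≤ 6 · C(n−4, 3)`, and `7479 · C(p, 3) ≤ 1326 · (2^{p−3} − 1)` for `p ≥ 15` (`tail_choose_le_pow`),
  `eTwoOne n ≤ 277/612` for `n ≥ 19` (`eTwoOne_le`).
**`qSumW_twoOne_ge_one`** is the statement of record.
-/

namespace PercRepro.Shadow

open Finset

/-- The crude count of the lossy covering bases by profile: `C(i, 3) · C(j, 2)`. -/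
def cntTwoOne (i j : ℕ) : ℕ := i.choose 3 * j.choose 2

/-- The chord of the cell `(2, 1)`: `(19 n + 193)/(72 (n − 2))`. -/
def eTwoOne (n : ℕ) : ℚ := (19 * (n : ℚ) + 193) / (72 * ((n : ℚ) - 2))

/-- `n = 9`. -/
theorem qSumW_twoOne_9 : 1 ≤ qSumW 5 4 3 2 (eTwoOne 9) cntTwoOne (vTwoOne 9) := by
  unfold qSumW eTwoOne cntTwoOne vTwoOne
  simp only [Finset.sum_range_succ, Finset.sum_range_zero]
  norm_num [Nat.choose]

/-- `n = 10`. -/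
theorem qSumW_twoOne_10 : 1 ≤ qSumW 6 4 3 2 (eTwoOne 10) cntTwoOne (vTwoOne 10) := by
  unfold qSumW eTwoOne cntTwoOne vTwoOne
  simp only [Finset.sum_range_succ, Finset.sum_range_zero]
  norm_num [Nat.choose]

/-- `n = 11`. -/
theorem qSumW_twoOne_11 : 1 ≤ qSumW 7 4 3 2 (eTwoOne 11) cntTwoOne (vTwoOne 11) := by
  unfold qSumW eTwoOne cntTwoOne vTwoOne
  simp only [Finset.sum_range_succ, Finset.sum_range_zero]
  norm_num [Nat.choose]

/-- `n = 12`. -/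
theorem qSumW_twoOne_12 : 1 ≤ qSumW 8 4 3 2 (eTwoOne 12) cntTwoOne (vTwoOne 12) := by
  unfold qSumW eTwoOne cntTwoOne vTwoOne
  simp only [Finset.sum_range_succ, Finset.sum_range_zero]
  norm_num [Nat.choose]

/-- `n = 13`. -/
theorem qSumW_twoOne_13 : 1 ≤ qSumW 9 4 3 2 (eTwoOne 13) cntTwoOne (vTwoOne 13) := by
  unfold qSumW eTwoOne cntTwoOne vTwoOne
  simp only [Finset.sum_range_succ, Finset.sum_range_zero]
  norm_num [Nat.choose]

/-- `n = 14`. -/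
theorem qSumW_twoOne_14 : 1 ≤ qSumW 10 4 3 2 (eTwoOne 14) cntTwoOne (vTwoOne 14) := by
  unfold qSumW eTwoOne cntTwoOne vTwoOne
  simp only [Finset.sum_range_succ, Finset.sum_range_zero]
  norm_num [Nat.choose]

/-- `n = 15`. -/
theorem qSumW_twoOne_15 : 1 ≤ qSumW 11 4 3 2 (eTwoOne 15) cntTwoOne (vTwoOne 15) := by
  unfold qSumW eTwoOne cntTwoOne vTwoOne
  simp only [Finset.sum_range_succ, Finset.sum_range_zero]
  norm_num [Nat.choose]

/-- `n = 16`. -/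
theorem qSumW_twoOne_16 : 1 ≤ qSumW 12 4 3 2 (eTwoOne 16) cntTwoOne (vTwoOne 16) := by
  unfold qSumW eTwoOne cntTwoOne vTwoOne
  simp only [Finset.sum_range_succ, Finset.sum_range_zero]
  norm_num [Nat.choose]

/-- `n = 17`. -/
theorem qSumW_twoOne_17 : 1 ≤ qSumW 13 4 3 2 (eTwoOne 17) cntTwoOne (vTwoOne 17) := by
  unfold qSumW eTwoOne cntTwoOne vTwoOne
  simp only [Finset.sum_range_succ, Finset.sum_range_zero]
  norm_num [Nat.choose]

/-- `n = 18`. -/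
theorem qSumW_twoOne_18 : 1 ≤ qSumW 14 4 3 2 (eTwoOne 18) cntTwoOne (vTwoOne 18) := by
  unfold qSumW eTwoOne cntTwoOne vTwoOne
  simp only [Finset.sum_range_succ, Finset.sum_range_zero]
  norm_num [Nat.choose]

/-- The chord is at most `277/612` from `n = 19` on. -/
theorem eTwoOne_le {n : ℕ} (hn : 19 ≤ n) : eTwoOne n ≤ 277 / 612 := by
  unfold eTwoOne
  have hn' : (19 : ℚ) ≤ (n : ℚ) := by exact_mod_cast hn
  rw [div_le_div_iff₀ (by linarith) (by norm_num)]
  linarith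

/-- The chord is positive. -/
theorem eTwoOne_pos {n : ℕ} (hn : 3 ≤ n) : 0 < eTwoOne n := by
  unfold eTwoOne
  have hn' : (3 : ℚ) ≤ (n : ℚ) := by exact_mod_cast hn
  apply div_pos (by linarith) (by linarith)

/-- **The tail arithmetic**: `7479 · C(p, 3) ≤ 1326 · (2^{p−3} − 1)` for `p ≥ 15`. -/
theorem tail_choose_le_pow {p : ℕ} (hp : 15 ≤ p) : 7479 * p.choose 3 ≤ 1326 * (2 ^ (p - 3) - 1) := by
  induction p, hp using Nat.le_induction with
  | base => decide
  | succ p hp ih =>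
    have h1 : (p + 1).choose 3 = p.choose 2 + p.choose 3 := Nat.choose_succ_succ p 2
    have h2 : p.choose 2 ≤ p.choose 3 := Nat.choose_le_succ_of_lt_half_left (by omega)
    have h3 : 2 ^ (p + 1 - 3) = 2 * 2 ^ (p - 3) := by
      rw [show p + 1 - 3 = (p - 3) + 1 by omega, pow_succ]; ring
    have h4 : 1 ≤ 2 ^ (p - 3) := Nat.one_le_two_pow
    rw [h1, h3]
    omega

/-- **THE TAIL**: the `j = 4` terms alone give a count sum `≥ 1` from `n = 19` on. -/
theorem qSumW_twoOne_tail {n : ℕ} (hn : 19 ≤ n) :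
    1 ≤ qSumW (n - 4) 4 3 2 (eTwoOne n) cntTwoOne (vTwoOne n) := by
  set p := n - 4 with hp
  have hp15 : 15 ≤ p := by omega
  have hE := eTwoOne_le hn
  have hEpos := eTwoOne_pos (by omega : 3 ≤ n)
  have hppos : (0 : ℚ) < (p.choose 3 : ℚ) := by exact_mod_cast Nat.choose_pos (by omega : 3 ≤ p)
  have h42 : (4 : ℕ).choose 2 = 6 := by decide
  have h22 : ((4 - 2 : ℕ).choose (4 - 2)) = 1 := by decide
  -- the generic term and its nonnegativity
  have hterm_nonneg : ∀ i j, 0 ≤ (if 3 ≤ i ∧ 2 ≤ j ∧ (i, j) ≠ (3, 2) then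
      ((p - 3).choose (i - 3) * (4 - 2).choose (j - 2) : ℚ) * (vTwoOne n i j / ((cntTwoOne i j : ℚ) * eTwoOne n))
      else 0) := by
    intro i j
    split_ifs
    · apply mul_nonneg (by positivity)
      apply div_nonneg (vTwoOne_nonneg n i j)
      exact mul_nonneg (by positivity) hEpos.le
    · exact le_refl _
  -- keep the terms with `j = 4`
  have hj4 : ∀ i ∈ Finset.range (p + 1), (if 3 ≤ i ∧ 2 ≤ 4 ∧ (i, 4) ≠ (3, 2) then
      ((p - 3).choose (i - 3) * (4 - 2).choose (4 - 2) : ℚ) * (vTwoOne n i 4 / ((cntTwoOne i 4 : ℚ) * eTwoOne n))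
      else 0) ≤ ∑ j ∈ Finset.range (4 + 1), (if 3 ≤ i ∧ 2 ≤ j ∧ (i, j) ≠ (3, 2) then
      ((p - 3).choose (i - 3) * (4 - 2).choose (j - 2) : ℚ) * (vTwoOne n i j / ((cntTwoOne i j : ℚ) * eTwoOne n))
      else 0) := by
    intro i _
    exact Finset.single_le_sum (fun j _ => hterm_nonneg i j) (by simp : 4 ∈ Finset.range (4 + 1))
  -- each `j = 4`, `i ≥ 4` term is at least `C(p−3, i−3) · (13/27) / (6 · C(p, 3) · E)`
  set c : ℚ := (13 / 27) / (6 * (p.choose 3 : ℚ) * eTwoOne n) with hc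
  have hden : (0 : ℚ) < 6 * (p.choose 3 : ℚ) * eTwoOne n := mul_pos (mul_pos (by norm_num) hppos) hEpos
  have hcpos : 0 < c := by rw [hc]; exact div_pos (by norm_num) hden
  have hlow : ∀ i ∈ Finset.range (p + 1), (if 4 ≤ i then ((p - 3).choose (i - 3) : ℚ) * c else 0) ≤
      (if 3 ≤ i ∧ 2 ≤ 4 ∧ (i, 4) ≠ (3, 2) then
      ((p - 3).choose (i - 3) * (4 - 2).choose (4 - 2) : ℚ) * (vTwoOne n i 4 / ((cntTwoOne i 4 : ℚ) * eTwoOne n))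
      else 0) := by
    intro i hi
    rw [Finset.mem_range] at hi
    by_cases h4 : 4 ≤ i
    · rw [if_pos h4, if_pos ⟨by omega, by norm_num, by simp⟩]
      have hv : (13 / 27 : ℚ) ≤ vTwoOne n i 4 := by
        unfold vTwoOne
        split_ifs <;> (try norm_num) <;> omega
      have hcnt : (cntTwoOne i 4 : ℚ) ≤ 6 * (p.choose 3 : ℚ) := by
        unfold cntTwoOne
        rw [h42]
        have : i.choose 3 ≤ p.choose 3 := Nat.choose_le_choose 3 (by omega)
        have h' : (i.choose 3 : ℚ) ≤ (p.choose 3 : ℚ) := by exact_mod_cast this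
        push_cast
        linarith
      have hcntpos : (0 : ℚ) < (cntTwoOne i 4 : ℚ) := by
        unfold cntTwoOne
        rw [h42]
        have : 0 < i.choose 3 := Nat.choose_pos (by omega)
        have h' : (0 : ℚ) < (i.choose 3 : ℚ) := by exact_mod_cast this
        push_cast
        linarith
      rw [h22, Nat.cast_one, mul_one]
      apply mul_le_mul_of_nonneg_left _ (by positivity)
      rw [hc, div_le_div_iff₀ hden (mul_pos hcntpos hEpos)]
      calc (13 / 27 : ℚ) * ((cntTwoOne i 4 : ℚ) * eTwoOne n)
          ≤ (13 / 27) * (6 * (p.choose 3 : ℚ) * eTwoOne n) :=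
            mul_le_mul_of_nonneg_left (mul_le_mul_of_nonneg_right hcnt hEpos.le) (by norm_num)
        _ ≤ vTwoOne n i 4 * (6 * (p.choose 3 : ℚ) * eTwoOne n) :=
            mul_le_mul_of_nonneg_right hv hden.le
    · rw [if_neg h4]
      exact hterm_nonneg i 4
  -- the sum of the lower bounds: `(2^{p−3} − 1) · c`
  have hsum : ∑ i ∈ Finset.range (p + 1), (if 4 ≤ i then ((p - 3).choose (i - 3) : ℚ) * c else 0) =
      ((2 ^ (p - 3) - 1 : ℕ) : ℚ) * c := by
    rw [← Finset.sum_filter]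
    have hfilt : (Finset.range (p + 1)).filter (fun i => 4 ≤ i) = Finset.Ico 4 (p + 1) := by
      ext i
      simp only [Finset.mem_filter, Finset.mem_range, Finset.mem_Ico]
      omega
    rw [hfilt, Finset.sum_Ico_eq_sum_range, show p + 1 - 4 = p - 3 by omega]
    have h1 : ∀ k ∈ Finset.range (p - 3), ((p - 3).choose (4 + k - 3) : ℚ) * c =
        ((p - 3).choose (k + 1) : ℚ) * c := by
      intro k _
      rw [show 4 + k - 3 = k + 1 by omega]
    rw [Finset.sum_congr rfl h1, ← Finset.sum_mul]
    congr 1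
    have h2 := Nat.sum_range_choose (p - 3)
    rw [Finset.sum_range_succ', Nat.choose_zero_right] at h2
    have h3 : (∑ k ∈ Finset.range (p - 3), (p - 3).choose (k + 1)) = 2 ^ (p - 3) - 1 := by omega
    exact_mod_cast h3
  -- assemble
  have hmain : ((2 ^ (p - 3) - 1 : ℕ) : ℚ) * c ≤ qSumW p 4 3 2 (eTwoOne n) cntTwoOne (vTwoOne n) := by
    unfold qSumW
    rw [← hsum]
    apply Finset.sum_le_sum
    intro i hi
    exact (hlow i hi).trans (hj4 i hi)
  refine le_trans ?_ hmain
  -- `(2^{p−3} − 1) · c ≥ 1` from the tail arithmetic and `E ≤ 277/612`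
  have htail := tail_choose_le_pow hp15
  have htail' : (7479 : ℚ) * (p.choose 3 : ℚ) ≤ 1326 * ((2 ^ (p - 3) - 1 : ℕ) : ℚ) := by
    exact_mod_cast htail
  rw [hc, ← mul_div_assoc, le_div_iff₀ hden, one_mul]
  have hE' : 6 * (p.choose 3 : ℚ) * eTwoOne n ≤ 6 * (p.choose 3 : ℚ) * (277 / 612) :=
    mul_le_mul_of_nonneg_left hE (by positivity)
  linarith

/-- **THE COUNT SUM OF A LOSSY BASIS PAIR OF THE CELL IS AT LEAST `1` AT EVERY `n ≥ 9`.** -/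
theorem qSumW_twoOne_ge_one {n : ℕ} (hn : 9 ≤ n) :
    1 ≤ qSumW (n - 4) 4 3 2 (eTwoOne n) cntTwoOne (vTwoOne n) := by
  rcases Nat.lt_or_ge n 19 with h | h
  · interval_cases n
    · exact qSumW_twoOne_9
    · exact qSumW_twoOne_10
    · exact qSumW_twoOne_11
    · exact qSumW_twoOne_12
    · exact qSumW_twoOne_13
    · exact qSumW_twoOne_14
    · exact qSumW_twoOne_15
    · exact qSumW_twoOne_16
    · exact qSumW_twoOne_17
    · exact qSumW_twoOne_18
  · exact qSumW_twoOne_tail h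

end PercRepro.Shadow
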